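import Mathlib
import Literature.NumberTheory.Sieve.LargestPrimeFactorCubicSawCount
import HarnessLib

/-!
# Pairs of linear congruences `d₀ ∣ q₀n + a₀`, `d₁ ∣ q₁n + a₁`: solvability, the count on an
# interval through the sawtooth, and the solution as a Kloosterman fraction

Topic `Literature/NumberTheory/Sieve` (elementary counting input of divisor-sum / dispersion
arguments for pairs of linear forms, e.g. the binary problems `Λ(q₀n+a₀)Λ(q₁n+a₁)`).  Everything is
PROVED and elementary; there are no definitions and no named facts.

For integers `q₀, a₀, q₁, a₁` with `gcd(q₀, a₀) = gcd(q₁, a₁) = 1` and moduli `d₀, d₁ ≥ 1` consider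
the set `𝒮 = {n ∈ ℤ : d₀ ∣ q₀ n + a₀, d₁ ∣ q₁ n + a₁}`.

* `pair_solvable_iff` — `𝒮 ≠ ∅` iff `gcd(d₀, q₀) = gcd(d₁, q₁) = 1` and `gcd(d₀, d₁) ∣ Δ`,
  `Δ = q₁ a₀ − q₀ a₁` (the resultant of the two linear forms);
* `pair_dvd_iff_modEq` — if `ν ∈ 𝒮` then `𝒮 = ν + lcm(d₀, d₁) ℤ`;
* `exists_nat_sol_lt_lcm` — a representative `0 ≤ ν < lcm(d₀, d₁)`;
* `card_Ioc_filter_pair_eq_saw` — the exact count on an interval of naturals,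
  `#{A < n ≤ A + U : n ∈ 𝒮} = U/L + ψ((A − ν)/L) − ψ((A + U − ν)/L)`, `L = lcm(d₀, d₁)`,
  `ψ(t) = t − [t] − 1/2` (`Literature.NumberTheory.LFunctions.AFE.saw`; from the tree's
  `HeathBrown2001.card_Ioc_filter_modEq_eq_saw`), and `card_Ioc_filter_pair_eq_zero` when `𝒮 = ∅`;
* `coprime_div_gcd_of_squarefree`, `exists_eq_mul_coprime_part` — two preliminaries for the
  application to squarefree moduli: `gcd(d₀, d₁/gcd(d₀,d₁)) = 1` for squarefree `d₁`, and the
  factorisation `q₁ = r q̃₁` with `gcd(q̃₁, q₀) = 1`, `r ∣ q₀^{q₁}`;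
* `exists_sol_eq_kloostermanFraction` — **the solution is a Kloosterman fraction.**  Write
  `q₁ = r q̃₁` and `d₁ = e d₁'` with `e ∣ d₀`, `e ∣ Δ`, and put `M = q̃₁ d₀`, `N = r q₀ d₁'`; if
  `gcd(M, N) = 1`, `u M ≡ 1 (mod N)` (`u = ((M : ZMod N)⁻¹).val`) and `w q̃₁ d₀ d₁' ≡ 1 (mod r)`, then
  some `ν ∈ 𝒮` satisfies, as an identity of real numbers,
  `ν/(d₀ d₁') = Δ u/N + a₁ w/r − a₀/(q₀ d₀ d₁')`.
  For `r = e = 1` (so `gcd(q₁ d₀, q₀ d₁) = 1`) this is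
  `ν/(d₀d₁) ≡ Δ \bar{q₁d₀}/(q₀d₁) − a₀q₁/((q₁d₀)(q₀d₁)) (mod 1)`: the phase `e(h ν/lcm(d₀,d₁))` of the
  count above is a bilinear Kloosterman fraction `e(k \bar m/n + X/(mn))` in `m = q̃₁ d₀`,
  `n = r q₀ d₁/e`, times a root of unity of order `r` depending only on `d₀ d₁/e (mod r)` — the shape
  of Duke–Friedlander–Iwaniec, *Bilinear forms with Kloosterman fractions* (Invent. Math. 128
  (1997)), Theorem 2, and of the Proposition of *Representations by the determinant …* (LMS LN 237
  (1997), p. 110).  In an application to a pair of primitive linear polynomials one takes `r` = the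
  `gcd(q₀,q₁)`-part of `q₁` (so that `q̃₁` is prime to `q₀`) and `e = gcd(d₀, d₁)` for squarefree
  `d₀, d₁`; then `gcd(M, N) = 1` is exactly the compatibility of the pair.

The proofs are Bezout manipulations; no appeal to the reciprocity law for `\bar m/n + \bar n/m` is
needed (the identity is verified directly on the explicit solution
`ν = (Δ u d₀ + a₁ w q₀ d₀ d₁' − a₀ r)/(r q₀)`).

## References

* W. Duke, J. Friedlander, H. Iwaniec, *Bilinear forms with Kloosterman fractions*, Invent. Math.
  128 (1997), 23–43 (the shape `e(k \bar m/n)`); *Representations by the determinant and mean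
  values of L-functions*, LMS Lecture Note Ser. 237 (1997), 109–115, p. 111 (the congruence
  `m₁ ≡ Δ \bar{n₂} (mod n₁)` behind Theorem 1). [folklore]
* D. R. Heath-Brown, Proc. London Math. Soc. (3) 82 (2001), §3 (3.2) (`#𝒜 = X/N + ψ − ψ`), for the
  sawtooth form of the count. [folklore]
-/

open Finset

namespace Literature.NumberTheory.Sieve.LinearCongruencePair

open Literature.NumberTheory.LFunctions.AFE (saw)

/-! ### One linear congruence `d ∣ q n + a` -/

/-- If `gcd(d, q) = 1` then `d ∣ q n + a` is solvable. [folklore] -/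
theorem exists_dvd_mul_add_of_isCoprime {d q : ℤ} (h : IsCoprime d q) (a : ℤ) :
    ∃ n : ℤ, d ∣ q * n + a := by
  obtain ⟨x, y, hxy⟩ := h
  refine ⟨-(a * y), ⟨a * x, ?_⟩⟩
  linear_combination (-a) * hxy

/-- If `gcd(q, a) = 1` and `d ∣ q n + a` for some `n`, then `gcd(d, q) = 1`. [folklore] -/
theorem isCoprime_of_dvd_mul_add {d q a n : ℤ} (hqa : IsCoprime q a) (h : d ∣ q * n + a) :
    IsCoprime d q := by
  obtain ⟨k, hk⟩ := h
  obtain ⟨x, y, hxy⟩ := hqa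
  refine ⟨y * k, x - y * n, ?_⟩
  linear_combination hxy - y * hk

/-- Two solutions of `d ∣ q n + a` with `gcd(d, q) = 1` are congruent modulo `d`. [folklore] -/
theorem dvd_sub_of_dvd_mul_add {d q a n n' : ℤ} (hdq : IsCoprime d q) (h : d ∣ q * n + a)
    (h' : d ∣ q * n' + a) : d ∣ n - n' := by
  have h1 : d ∣ q * (n - n') := by
    have := dvd_sub h h'
    rwa [show q * n + a - (q * n' + a) = q * (n - n') by ring] at this
  exact hdq.dvd_of_dvd_mul_left h1

/-- The solution set of `d ∣ q n + a` is a union of classes modulo `d`. [folklore] -/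
theorem dvd_mul_add_of_dvd_sub {d q a n n' : ℤ} (h : d ∣ q * n + a) (hn : d ∣ n' - n) :
    d ∣ q * n' + a := by
  have : q * n' + a = (q * n + a) + q * (n' - n) := by ring
  rw [this]
  exact dvd_add h (dvd_mul_of_dvd_right hn q)

/-! ### The pair: solvability -/

section Pair

variable {d₀ d₁ : ℕ} {q₀ a₀ q₁ a₁ : ℤ}

/-- If the pair `d₀ ∣ q₀n + a₀`, `d₁ ∣ q₁n + a₁` has a solution then `gcd(d₀, d₁) ∣ q₁a₀ − q₀a₁`
(`Δ = q₁(q₀n + a₀) − q₀(q₁n + a₁)`). [folklore] -/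
theorem gcd_dvd_resultant_of_sol {n : ℤ} (h₀ : (d₀ : ℤ) ∣ q₀ * n + a₀)
    (h₁ : (d₁ : ℤ) ∣ q₁ * n + a₁) : ((Nat.gcd d₀ d₁ : ℕ) : ℤ) ∣ q₁ * a₀ - q₀ * a₁ := by
  have e0 : ((Nat.gcd d₀ d₁ : ℕ) : ℤ) ∣ (d₀ : ℤ) := Int.natCast_dvd_natCast.2 (Nat.gcd_dvd_left _ _)
  have e1 : ((Nat.gcd d₀ d₁ : ℕ) : ℤ) ∣ (d₁ : ℤ) := Int.natCast_dvd_natCast.2 (Nat.gcd_dvd_right _ _)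
  have : q₁ * a₀ - q₀ * a₁ = q₁ * (q₀ * n + a₀) - q₀ * (q₁ * n + a₁) := by ring
  rw [this]
  exact dvd_sub (dvd_mul_of_dvd_right (e0.trans h₀) _) (dvd_mul_of_dvd_right (e1.trans h₁) _)

/-- **Solvability of a pair of linear congruences.**  For `gcd(q₀,a₀) = gcd(q₁,a₁) = 1` the system
`d₀ ∣ q₀ n + a₀`, `d₁ ∣ q₁ n + a₁` is solvable iff `gcd(d₀, q₀) = gcd(d₁, q₁) = 1` and
`gcd(d₀, d₁) ∣ Δ = q₁ a₀ − q₀ a₁`. [folklore] -/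
theorem pair_solvable_iff (hq₀ : IsCoprime q₀ a₀) (hq₁ : IsCoprime q₁ a₁) :
    (∃ n : ℤ, (d₀ : ℤ) ∣ q₀ * n + a₀ ∧ (d₁ : ℤ) ∣ q₁ * n + a₁) ↔
      IsCoprime (d₀ : ℤ) q₀ ∧ IsCoprime (d₁ : ℤ) q₁ ∧
        ((Nat.gcd d₀ d₁ : ℕ) : ℤ) ∣ q₁ * a₀ - q₀ * a₁ := by
  constructor
  · rintro ⟨n, h₀, h₁⟩
    exact ⟨isCoprime_of_dvd_mul_add hq₀ h₀, isCoprime_of_dvd_mul_add hq₁ h₁,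
      gcd_dvd_resultant_of_sol h₀ h₁⟩
  · rintro ⟨hc₀, hc₁, hΔ⟩
    obtain ⟨ν₀, hν₀⟩ := exists_dvd_mul_add_of_isCoprime hc₀ a₀
    obtain ⟨ν₁, hν₁⟩ := exists_dvd_mul_add_of_isCoprime hc₁ a₁
    set e : ℕ := Nat.gcd d₀ d₁ with he
    have e0 : ((e : ℕ) : ℤ) ∣ (d₀ : ℤ) := Int.natCast_dvd_natCast.2 (Nat.gcd_dvd_left _ _)
    have e1 : ((e : ℕ) : ℤ) ∣ (d₁ : ℤ) := Int.natCast_dvd_natCast.2 (Nat.gcd_dvd_right _ _)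
    -- `e ∣ ν₀ − ν₁`
    have hq : (e : ℤ) ∣ q₀ * q₁ * (ν₀ - ν₁) := by
      have : q₀ * q₁ * (ν₀ - ν₁) = q₁ * (q₀ * ν₀ + a₀) - q₀ * (q₁ * ν₁ + a₁) - (q₁ * a₀ - q₀ * a₁) := by
        ring
      rw [this]
      exact dvd_sub (dvd_sub (dvd_mul_of_dvd_right (e0.trans hν₀) _)
        (dvd_mul_of_dvd_right (e1.trans hν₁) _)) hΔ
    have hce : IsCoprime (e : ℤ) (q₀ * q₁) :=
      IsCoprime.mul_right (hc₀.of_isCoprime_of_dvd_left e0) (hc₁.of_isCoprime_of_dvd_left e1)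
    have hediff : (e : ℤ) ∣ ν₀ - ν₁ := hce.dvd_of_dvd_mul_left hq
    obtain ⟨t, ht⟩ := hediff
    -- Bezout for `d₀, d₁`
    have hbez : ((e : ℕ) : ℤ) = (d₀ : ℤ) * Nat.gcdA d₀ d₁ + (d₁ : ℤ) * Nat.gcdB d₀ d₁ := by
      rw [he]; exact Nat.gcd_eq_gcd_ab d₀ d₁
    refine ⟨ν₀ - (d₀ : ℤ) * Nat.gcdA d₀ d₁ * t, ?_, ?_⟩
    · refine dvd_mul_add_of_dvd_sub hν₀ ⟨-(Nat.gcdA d₀ d₁ * t), by ring⟩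
    · refine dvd_mul_add_of_dvd_sub hν₁ ⟨Nat.gcdB d₀ d₁ * t, ?_⟩
      linear_combination ht + t * hbez

/-- **The solutions form one class modulo `lcm(d₀, d₁)`.**  If `ν` solves the pair
(`gcd(qᵢ, aᵢ) = 1`), then `n` solves it iff `n ≡ ν (mod lcm(d₀, d₁))`. [folklore] -/
theorem pair_dvd_iff_modEq (hq₀ : IsCoprime q₀ a₀) (hq₁ : IsCoprime q₁ a₁) {ν : ℤ}
    (hν₀ : (d₀ : ℤ) ∣ q₀ * ν + a₀) (hν₁ : (d₁ : ℤ) ∣ q₁ * ν + a₁) (n : ℤ) :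
    ((d₀ : ℤ) ∣ q₀ * n + a₀ ∧ (d₁ : ℤ) ∣ q₁ * n + a₁) ↔ n ≡ ν [ZMOD (Nat.lcm d₀ d₁ : ℕ)] := by
  have hl : ((Nat.lcm d₀ d₁ : ℕ) : ℤ) = Int.lcm (d₀ : ℤ) (d₁ : ℤ) := by
    rw [Int.lcm_natCast_natCast]
  rw [hl, ← Int.modEq_and_modEq_iff_modEq_lcm, Int.modEq_comm, Int.modEq_iff_dvd,
    Int.modEq_comm, Int.modEq_iff_dvd]
  constructor
  · rintro ⟨h₀, h₁⟩
    exact ⟨dvd_sub_of_dvd_mul_add (isCoprime_of_dvd_mul_add hq₀ hν₀) h₀ hν₀,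
      dvd_sub_of_dvd_mul_add (isCoprime_of_dvd_mul_add hq₁ hν₁) h₁ hν₁⟩
  · rintro ⟨h₀, h₁⟩
    exact ⟨dvd_mul_add_of_dvd_sub hν₀ h₀, dvd_mul_add_of_dvd_sub hν₁ h₁⟩

/-- A solvable pair (`gcd(qᵢ, aᵢ) = 1`, `d₀, d₁ ≥ 1`) has a natural solution `ν < lcm(d₀, d₁)`.
[folklore] -/
theorem exists_nat_sol_lt_lcm (hd₀ : 0 < d₀) (hd₁ : 0 < d₁)
    (h : ∃ n : ℤ, (d₀ : ℤ) ∣ q₀ * n + a₀ ∧ (d₁ : ℤ) ∣ q₁ * n + a₁) :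
    ∃ ν : ℕ, ν < Nat.lcm d₀ d₁ ∧ (d₀ : ℤ) ∣ q₀ * ν + a₀ ∧ (d₁ : ℤ) ∣ q₁ * ν + a₁ := by
  obtain ⟨n, h₀, h₁⟩ := h
  have hL : 0 < Nat.lcm d₀ d₁ := Nat.lcm_pos hd₀ hd₁
  have hLz : (0 : ℤ) < (Nat.lcm d₀ d₁ : ℕ) := by exact_mod_cast hL
  refine ⟨(n % (Nat.lcm d₀ d₁ : ℕ)).toNat, ?_, ?_, ?_⟩
  · have h1 : n % (Nat.lcm d₀ d₁ : ℕ) < (Nat.lcm d₀ d₁ : ℕ) := Int.emod_lt_of_pos n hLz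
    have h2 : 0 ≤ n % (Nat.lcm d₀ d₁ : ℕ) := Int.emod_nonneg n hLz.ne'
    omega
  · have h2 : 0 ≤ n % (Nat.lcm d₀ d₁ : ℕ) := Int.emod_nonneg n hLz.ne'
    rw [Int.natCast_toNat_eq_self.2 h2]
    refine dvd_mul_add_of_dvd_sub h₀ ?_
    have hd : (d₀ : ℤ) ∣ ((Nat.lcm d₀ d₁ : ℕ) : ℤ) := Int.natCast_dvd_natCast.2 (Nat.dvd_lcm_left _ _)
    exact hd.trans (Int.modEq_iff_dvd.1 (Int.mod_modEq n _).symm)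
  · have h2 : 0 ≤ n % (Nat.lcm d₀ d₁ : ℕ) := Int.emod_nonneg n hLz.ne'
    rw [Int.natCast_toNat_eq_self.2 h2]
    refine dvd_mul_add_of_dvd_sub h₁ ?_
    have hd : (d₁ : ℤ) ∣ ((Nat.lcm d₀ d₁ : ℕ) : ℤ) := Int.natCast_dvd_natCast.2 (Nat.dvd_lcm_right _ _)
    exact hd.trans (Int.modEq_iff_dvd.1 (Int.mod_modEq n _).symm)

/-! ### The pair: the exact count on an interval through the sawtooth -/

/-- **The count of solutions on an interval** (solvable case): if `ν ∈ ℕ` solves the pair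
(`gcd(qᵢ, aᵢ) = 1`, `d₀, d₁ ≥ 1`), then for all `A, U`,
`#{A < n ≤ A + U : d₀ ∣ q₀n + a₀, d₁ ∣ q₁n + a₁} = U/L + ψ((A − ν)/L) − ψ((A + U − ν)/L)`,
`L = lcm(d₀, d₁)`. [folklore] -/
theorem card_Ioc_filter_pair_eq_saw (hq₀ : IsCoprime q₀ a₀) (hq₁ : IsCoprime q₁ a₁)
    (hd₀ : 0 < d₀) (hd₁ : 0 < d₁) {ν : ℕ}
    (hν₀ : (d₀ : ℤ) ∣ q₀ * ν + a₀) (hν₁ : (d₁ : ℤ) ∣ q₁ * ν + a₁) (A U : ℕ) :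
    (#((Ioc A (A + U)).filter fun n : ℕ => (d₀ : ℤ) ∣ q₀ * n + a₀ ∧ (d₁ : ℤ) ∣ q₁ * n + a₁) : ℝ) =
      (U : ℝ) / (Nat.lcm d₀ d₁ : ℕ) + saw (((A : ℝ) - ν) / (Nat.lcm d₀ d₁ : ℕ)) -
        saw (((A : ℝ) + U - ν) / (Nat.lcm d₀ d₁ : ℕ)) := by
  have hL : 0 < Nat.lcm d₀ d₁ := Nat.lcm_pos hd₀ hd₁
  have hfilter : ((Ioc A (A + U)).filter fun n : ℕ => (d₀ : ℤ) ∣ q₀ * n + a₀ ∧ (d₁ : ℤ) ∣ q₁ * n + a₁)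
      = (Ioc A (A + U)).filter fun n : ℕ => n ≡ ν [MOD Nat.lcm d₀ d₁] := by
    refine Finset.filter_congr fun n _ => ?_
    rw [pair_dvd_iff_modEq hq₀ hq₁ hν₀ hν₁, Int.natCast_modEq_iff]
  rw [hfilter]
  exact HeathBrown2001.card_Ioc_filter_modEq_eq_saw hL A U ν

/-- **The count of solutions on an interval** (unsolvable case): if the pair has no integer
solution, the count is `0`. [folklore] -/
theorem card_Ioc_filter_pair_eq_zero
    (h : ¬ ∃ n : ℤ, (d₀ : ℤ) ∣ q₀ * n + a₀ ∧ (d₁ : ℤ) ∣ q₁ * n + a₁) (A B : ℕ) :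
    #((Ioc A B).filter fun n : ℕ => (d₀ : ℤ) ∣ q₀ * n + a₀ ∧ (d₁ : ℤ) ∣ q₁ * n + a₁) = 0 := by
  rw [Finset.card_eq_zero, Finset.filter_eq_empty_iff]
  intro n _ hn
  exact h ⟨n, hn⟩

end Pair

/-! ### Two arithmetic preliminaries for the application to squarefree moduli -/

/-- For squarefree `d₁`, `d₀` is prime to `d₁ / gcd(d₀, d₁)` (a common prime `p` would give
`p² ∣ d₁`). [folklore] -/
theorem coprime_div_gcd_of_squarefree {d₀ d₁ : ℕ} (h : Squarefree d₁) :
    Nat.Coprime d₀ (d₁ / Nat.gcd d₀ d₁) := by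
  set e := Nat.gcd d₀ d₁ with he
  have hd₁ : d₁ = e * (d₁ / e) := (Nat.mul_div_cancel' (Nat.gcd_dvd_right d₀ d₁)).symm
  refine Nat.coprime_of_dvd fun p hp hpd₀ hpd' => ?_
  have hpd₁ : p ∣ d₁ := hpd'.trans (Nat.div_dvd_of_dvd (Nat.gcd_dvd_right d₀ d₁))
  have hpe : p ∣ e := Nat.dvd_gcd hpd₀ hpd₁
  have hpp : p * p ∣ d₁ := by rw [hd₁]; exact Nat.mul_dvd_mul hpe hpd'
  exact hp.ne_one (Nat.isUnit_iff.1 (h p hpp))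

/-- **The `q₀`-part of `q₁`.**  For `q₁ ≥ 1` one can write `q₁ = r q̃` with `gcd(q̃, q₀) = 1` and
`r ∣ q₀^{q₁}` (so every prime of `r` divides `q₀`; `r = ∏_{p ∣ q₀} p^{v_p(q₁)}` when `q₀ ≥ 1`).  In
particular anything prime to `q₀` is prime to `r`, and `gcd(q̃, r) = 1`. [folklore] -/
theorem exists_eq_mul_coprime_part (q₀ : ℕ) :
    ∀ q₁ : ℕ, 0 < q₁ → ∃ r qt : ℕ, 0 < r ∧ q₁ = r * qt ∧ Nat.Coprime qt q₀ ∧ r ∣ q₀ ^ q₁ := by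
  intro q₁
  induction q₁ using Nat.strong_induction_on with
  | _ q₁ ih =>
    intro hq₁
    by_cases hc : Nat.Coprime q₁ q₀
    · exact ⟨1, q₁, one_pos, (one_mul _).symm, hc, one_dvd _⟩
    · set g := Nat.gcd q₁ q₀ with hg
      have hg1 : 1 < g := by
        rcases Nat.lt_or_ge 1 g with h | h
        · exact h
        · exfalso
          have hg0 : 0 < g := Nat.gcd_pos_of_pos_left _ hq₁
          exact hc (show Nat.gcd q₁ q₀ = 1 by rw [← hg]; omega)
      have hgq₁ : g ∣ q₁ := Nat.gcd_dvd_left _ _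
      set q₁' := q₁ / g with hq₁'
      have hq₁eq : q₁ = g * q₁' := (Nat.mul_div_cancel' hgq₁).symm
      have hq₁'pos : 0 < q₁' := Nat.div_pos (Nat.le_of_dvd hq₁ hgq₁) (by omega)
      have hlt : q₁' < q₁ := by
        rw [hq₁eq]
        calc q₁' = 1 * q₁' := (one_mul _).symm
          _ < g * q₁' := Nat.mul_lt_mul_of_pos_right hg1 hq₁'pos
      obtain ⟨r', qt, hr', hq₁'', hcop, hr'dvd⟩ := ih q₁' hlt hq₁'pos
      refine ⟨g * r', qt, Nat.mul_pos (by omega) hr', by rw [hq₁eq, hq₁'', mul_assoc], hcop, ?_⟩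
      have hgq₀ : g ∣ q₀ := Nat.gcd_dvd_right _ _
      calc g * r' ∣ q₀ * q₀ ^ q₁' := Nat.mul_dvd_mul hgq₀ hr'dvd
        _ = q₀ ^ (q₁' + 1) := by ring
        _ ∣ q₀ ^ q₁ := Nat.pow_dvd_pow q₀ (by omega)

/-! ### The solution as a Kloosterman fraction -/

/-- **The solution of a pair of linear congruences is a Kloosterman fraction.**  Let
`q₀, q̃₁, r, d₀, d₁' ≥ 1`, `e ∣ d₀`, put `q₁ = r q̃₁`, `d₁ = e d₁'`, `Δ = q₁ a₀ − q₀ a₁` and assume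
`e ∣ Δ`.  Let `M = q̃₁ d₀`, `N = r q₀ d₁'` be coprime, `u = ((M : ZMod N)⁻¹).val` (so `uM ≡ 1 (mod N)`)
and `w q̃₁ d₀ d₁' ≡ 1 (mod r)`.  Then there is an integer `ν` with `d₀ ∣ q₀ ν + a₀`, `d₁ ∣ q₁ ν + a₁`
and
`ν/(d₀ d₁') = Δ u/N + a₁ w/r − a₀/(q₀ d₀ d₁')`
(exactly, in `ℝ`).  Explicitly `ν = (Δ u d₀ + a₁ w q₀ d₀ d₁' − a₀ r)/(r q₀)`.  Consequently
`e(h ν'/lcm(d₀,d₁)) = e(hΔ \bar M/N − h a₀ q₁/(MN)) · e(h a₁ w/r)` for every solution `ν'` when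
`e = gcd(d₀, d₁)` (all solutions are `≡ ν (mod lcm)`): a bilinear Kloosterman fraction in
`m = M`, `n = N` of the Duke–Friedlander–Iwaniec shape `e(k \bar m/n + X/(mn))`. [folklore] -/
theorem exists_sol_eq_kloostermanFraction (q₀ q₁t r d₀ d₁' e : ℕ) (a₀ a₁ : ℤ)
    (hq₀ : 0 < q₀) (hr : 0 < r) (hd₀ : 0 < d₀) (hd₁' : 0 < d₁') (hed₀ : e ∣ d₀)
    (hΔ : (e : ℤ) ∣ ((r * q₁t : ℕ) : ℤ) * a₀ - (q₀ : ℤ) * a₁)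
    (hMN : Nat.Coprime (q₁t * d₀) (r * q₀ * d₁'))
    (w : ℤ) (hw : w * ((q₁t * d₀ * d₁' : ℕ) : ℤ) ≡ 1 [ZMOD (r : ℕ)]) :
    ∃ ν : ℤ, (d₀ : ℤ) ∣ (q₀ : ℤ) * ν + a₀ ∧ ((e * d₁' : ℕ) : ℤ) ∣ ((r * q₁t : ℕ) : ℤ) * ν + a₁ ∧
      (ν : ℝ) / ((d₀ : ℝ) * d₁') =
        ((((r * q₁t : ℕ) : ℤ) * a₀ - (q₀ : ℤ) * a₁ : ℤ) : ℝ) *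
            ((((q₁t * d₀ : ℕ) : ZMod (r * q₀ * d₁')))⁻¹.val : ℝ) / ((r * q₀ * d₁' : ℕ) : ℝ) +
          (a₁ : ℝ) * w / r - (a₀ : ℝ) / ((q₀ : ℝ) * d₀ * d₁') := by
  -- names
  set M : ℕ := q₁t * d₀ with hM
  set N : ℕ := r * q₀ * d₁' with hN
  set u : ℕ := ((M : ZMod N))⁻¹.val with hu
  set Δ : ℤ := ((r * q₁t : ℕ) : ℤ) * a₀ - (q₀ : ℤ) * a₁ with hΔdef
  have hN0 : 0 < N := by rw [hN]; positivity
  -- `M u ≡ 1 (mod N)`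
  have hMu : (N : ℤ) ∣ (M : ℤ) * u - 1 := by
    haveI : NeZero N := ⟨hN0.ne'⟩
    have h1 : ((M : ZMod N)) * ((M : ZMod N))⁻¹ = 1 := ZMod.coe_mul_inv_eq_one M hMN
    have h2 : (((M : ℤ) * u - 1 : ℤ) : ZMod N) = 0 := by
      push_cast
      rw [hu, ZMod.natCast_zmod_val, h1, sub_self]
    exact (ZMod.intCast_zmod_eq_zero_iff_dvd _ N).1 h2
  obtain ⟨K, hK⟩ := hMu
  -- coprimality consequences of `gcd(M, N) = 1`
  have hrN : r ∣ N := ⟨q₀ * d₁', by rw [hN]; ring⟩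
  have hq₀N : q₀ ∣ N := ⟨r * d₁', by rw [hN]; ring⟩
  have hd₁N : d₁' ∣ N := ⟨r * q₀, by rw [hN]; ring⟩
  have hcop_q₁t_r : Nat.Coprime q₁t r :=
    Nat.Coprime.coprime_dvd_left (dvd_mul_right q₁t d₀) (Nat.Coprime.coprime_dvd_right hrN hMN)
  have hcop_d₀_r : Nat.Coprime d₀ r :=
    Nat.Coprime.coprime_dvd_left (dvd_mul_left d₀ q₁t) (Nat.Coprime.coprime_dvd_right hrN hMN)
  -- `r ∣ w L − u d₀`, `L = d₀ d₁'`
  have hr_dvd : (r : ℤ) ∣ w * ((d₀ : ℤ) * d₁') - (u : ℤ) * d₀ := by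
    -- `q̃₁ (wL − u d₀) ≡ q̃₁ w L − (M u) ≡ 1 − 1 (mod r)`
    have h1 : (r : ℤ) ∣ (q₁t : ℤ) * (w * ((d₀ : ℤ) * d₁') - (u : ℤ) * d₀) := by
      have e1 : (q₁t : ℤ) * (w * ((d₀ : ℤ) * d₁') - (u : ℤ) * d₀) =
          (w * ((q₁t * d₀ * d₁' : ℕ) : ℤ) - 1) - ((M : ℤ) * u - 1) := by
        rw [hM]; push_cast; ring
      rw [e1]
      refine dvd_sub hw.symm.dvd ?_
      rw [hK]; exact Dvd.dvd.mul_right (Int.natCast_dvd_natCast.2 hrN) K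
    have hc : IsCoprime (r : ℤ) (q₁t : ℤ) := Nat.isCoprime_iff_coprime.2 hcop_q₁t_r.symm
    exact hc.dvd_of_dvd_mul_left h1
  obtain ⟨T, hT⟩ := hr_dvd
  -- the explicit solution: `r q₀ ν = Z := Δ u d₀ + a₁ w q₀ L − a₀ r`
  -- `Z = a₀ r (M u − 1) + q₀ a₁ (w L − u d₀) = a₀ r N K + q₀ a₁ r T`
  have hZ : Δ * u * d₀ + a₁ * w * q₀ * ((d₀ : ℤ) * d₁') - a₀ * r =
      (r : ℤ) * q₀ * (a₀ * ((r : ℤ) * d₁') * K + a₁ * T) := by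
    have e1 : Δ * u * d₀ + a₁ * w * q₀ * ((d₀ : ℤ) * d₁') - a₀ * r =
        a₀ * r * ((M : ℤ) * u - 1) + q₀ * a₁ * (w * ((d₀ : ℤ) * d₁') - (u : ℤ) * d₀) := by
      rw [hΔdef, hM]; push_cast; ring
    rw [e1, hK, hT, hN]; push_cast; ring
  set ν : ℤ := a₀ * ((r : ℤ) * d₁') * K + a₁ * T with hνdef
  have hν : (r : ℤ) * q₀ * ν = Δ * u * d₀ + a₁ * w * q₀ * ((d₀ : ℤ) * d₁') - a₀ * r := by
    rw [hZ]
  have hr0 : (r : ℤ) ≠ 0 := by exact_mod_cast hr.ne'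
  have hq0 : (q₀ : ℤ) ≠ 0 := by exact_mod_cast hq₀.ne'
  refine ⟨ν, ?_, ?_, ?_⟩
  · -- `d₀ ∣ q₀ ν + a₀`: `r (q₀ ν + a₀) = Δ u d₀ + a₁ w q₀ d₀ d₁'` and `gcd(d₀, r) = 1`
    have h1 : (d₀ : ℤ) ∣ (r : ℤ) * ((q₀ : ℤ) * ν + a₀) := by
      have e1 : (r : ℤ) * ((q₀ : ℤ) * ν + a₀) = (r : ℤ) * q₀ * ν + a₀ * r := by ring
      rw [e1, hν]
      exact ⟨Δ * u + a₁ * w * q₀ * d₁', by ring⟩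
    have hc : IsCoprime (d₀ : ℤ) (r : ℤ) := Nat.isCoprime_iff_coprime.2 hcop_d₀_r
    exact hc.dvd_of_dvd_mul_left h1
  · -- `d₁ = e d₁' ∣ q₁ ν + a₁`: `q₀ (q₁ ν + a₁) = Δ (M u − 1) + q̃₁ a₁ w q₀ d₀ d₁'`, both divisible by
    -- `q₀ e d₁'` (`N ∣ Mu − 1`, `e ∣ Δ`, `e ∣ d₀`), then cancel `q₀`.
    have h1 : (q₀ : ℤ) * (((r * q₁t : ℕ) : ℤ) * ν + a₁) =
        Δ * ((M : ℤ) * u - 1) + (q₁t : ℤ) * a₁ * w * q₀ * ((d₀ : ℤ) * d₁') := by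
      have e1 : (q₀ : ℤ) * (((r * q₁t : ℕ) : ℤ) * ν + a₁) = (q₁t : ℤ) * ((r : ℤ) * q₀ * ν) + q₀ * a₁ := by
        push_cast; ring
      rw [e1, hν, hΔdef, hM]; push_cast; ring
    obtain ⟨d₀', hd₀'⟩ := hed₀
    obtain ⟨D, hD⟩ := hΔ
    have h2 : (q₀ : ℤ) * ((e * d₁' : ℕ) : ℤ) ∣ (q₀ : ℤ) * (((r * q₁t : ℕ) : ℤ) * ν + a₁) := by
      rw [h1, hK, hD, hN, hd₀']
      push_cast
      exact ⟨D * r * K + (q₁t : ℤ) * a₁ * w * d₀', by ring⟩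
    exact (mul_dvd_mul_iff_left hq0).1 h2
  · -- the real identity, from `r q₀ ν = Z`
    have hνR : (r : ℝ) * q₀ * ν = (Δ : ℝ) * u * d₀ + a₁ * w * q₀ * ((d₀ : ℝ) * d₁') - a₀ * r := by
      exact_mod_cast hν
    have hr' : (r : ℝ) ≠ 0 := by exact_mod_cast hr.ne'
    have hq' : (q₀ : ℝ) ≠ 0 := by exact_mod_cast hq₀.ne'
    have hd0' : (d₀ : ℝ) ≠ 0 := by exact_mod_cast hd₀.ne'
    have hd1' : (d₁' : ℝ) ≠ 0 := by exact_mod_cast hd₁'.ne'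
    have key : (ν : ℝ) = ((Δ : ℝ) * u * d₀ + a₁ * w * q₀ * ((d₀ : ℝ) * d₁') - a₀ * r) / (r * q₀) := by
      rw [← hνR]; field_simp
    rw [key, hN]
    push_cast
    field_simp

end Literature.NumberTheory.Sieve.LinearCongruencePair
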